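import Mathlib
import HarnessLib
import HarnessLib.Audit
import Summits.CriticalPhenomena.Statement
import HarnessLib.Audit.Status.Attr

/-!
Route: CurrentConnectionInvariance

# Route CurrentConnectionInvariance — Cardy-type target on Z^3 — Moebius covariance of all spin
n-point limits from Moebius INVARIANCE of weight-free double-current ratios

CURRENT–CONNECTION INVARIANCE (idea card
CriticalPhenomena/Ising3DConformalLimit/current-connection-invariance). For even n ≥ 2, mesh δ > 0
and x = (x₁,…,x_{n+2}) ∈ (ℝ³)^{n+2} put G^δ_m(y) := ⟨∏ᵢ σ_{[yᵢ/δ]}⟩⁺_{β_c(3)} (= rescaledCorrelator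
(criticalCorr 3) 1 m δ y: renormalisation ρ ≡ 1) and the WEIGHT-FREE RATIO R^δ_n(x) :=
G^δ_n(x₁..x_n) · G^δ_2(x_{n+1},x_{n+2}) / G^δ_{n+2}(x₁..x_{n+2}) ∈ (0,1]. By the switching lemma
(AizenmanDuminilCopinAnnals2021 §3.2, Lemma 3.3 and the display after it, arXiv pp. 8–9;
AizenmanCMP1982) R^δ_n(x) = P^{A∪{a,b},∅}_{β_c}[a ↔ b in n₁+n₂], A = {[xᵢ/δ]}_{i≤n}, a, b the last
two sites: a CONNECTION PROBABILITY of a sourced double random current, in which the conformal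
weights ∏|φ′(xᵢ)|^{−Δ} of any Möbius map φ cancel identically (each point occurs once upstairs, once
downstairs). It suffices to show X_CCI = (I) ∧ (L) ∧ (O) ∧ (U) ∧ (T):
(I) RatioInversionInvariance [crux r2, the Cardy-type target]: R^δ_n(ι∘x) − R^δ_n(x) → 0 as δ → 0⁺,
ι(y) = y/|y|² the unit inversion, for every even n ≥ 2 and every non-coincident x avoiding 0;
(L) RatioLimit [crux r3]: R^δ_n → p_n as δ → 0⁺ (full filter), locally uniformly on NonCoincident 3
(n+2), with p_n continuous and > 0 there (translation and dilation invariance of p_n are then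
automatic: R^δ_n(x+δm) = R^δ_n(x) for m ∈ ℤ³ and R^δ_n(c·x) = R^{δ/c}_n(x) hold EXACTLY on the
lattice);
(O) RatioRotationInvariance [crux r4]: R^δ_n(A∘x) − R^δ_n(x) → 0 for every A ∈ O(3);
(U) NormalisedU4Nonvanishing [crux r5]: at one non-coincident 4-tuple, |U₄^δ(x)| ≥
ε·G^δ_2(x₀,x₁)G^δ_2(x₂,x₃) with ε > 0 along a sequence δ_k → 0⁺, U₄^δ the lattice Ursell function —
by AizenmanDuminilCopinAnnals2021 eq. (3.11) this says two sourced double-current clusters at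
macroscopic separation MERGE with probability ≥ ε/2 (Δ-free, ρ-free form of clause (iii));
(T) = item stmt-CriticalPhenomena-0634, decl IsingEuclidUpgradeR2RotInvPowerLaw [crux r6, SHARED
with route IsingEuclidUpgrade]: ⟨σ₀σ_x⟩_{β_c(3)}·‖x‖₂^{2Δ} → c > 0 — the only place where Δ and the
renormalisation enter.
Lean: `RatioInversionInvariance ∧ RatioLimit ∧ RatioRotationInvariance ∧ NormalisedU4Nonvanishing ∧
IsingEuclidUpgradeR2RotInvPowerLaw` (the five decls of namespace
Summit.CriticalPhenomena.Ising3DConformalLimit.Theses.CurrentConnectionInvariance whose one-line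
terms are the items below; every term elaborates rc 0 in the planner's Sketch.lean against Mathlib +
Summits.CriticalPhenomena.Statement, over Literature.Probability.LatticeModels.{rescaledCorrelator,
criticalCorr, criticalTwoPoint, latticeApprox, NonCoincident, Site}, EuclideanGeometry.inversion,
LinearIsometryEquiv, TendstoLocallyUniformlyOn, Filter.Tendsto, Filter.Frequently, nhdsWithin — each
`lean search --decl`-verified / elaborated).

## Assembly
TELESCOPED RECONSTRUCTION (elementary but not one screen; all library inputs are PROVED cone facts).
From (T) take Δ, c and put ρ(δ) := δ^{−Δ} (> 0 on (0,1]); criticalTwoPoint_bounds_holds (3 ≤ 3)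
forces Δ ≥ 1/2 > 0. Define S : CorrFamily 3 by S 0 := 1, S odd := 0, S 2 x := c‖x₀−x₁‖^{−2Δ} (= 0 at
coincidence by Real.zero_rpow), and for even n ≥ 2, S (n+2) x := if Injective x then S n
(x∘Fin.castAdd 2) · S 2 (x∘Fin.natAdd n) / p_n x else 0, with p_n from (L). (a)
HasPointwiseScalingLimit: n = 0 from criticalCorr 3 0 ≡ 1 (plusExpect of the constant 1, limUnder of
a constant sequence); odd n: criticalCorr vanishes identically (exists_spinMonomial_eq_spinProduct +
plusCorr_eq_zero_of_odd_card + spontaneousMagnetization_criticalBeta_eq_zero_holds +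
criticalBeta_nonneg); n = 2: ⟨σ_aσ_b⟩ = criticalTwoPoint 3 (b − a) (plusCorr_shift), ‖[y/δ]−[x/δ]‖ =
‖y−x‖/δ + O(1) uniformly, and the cofinite limit (T) gives δ^{−2Δ}G → c‖x−y‖^{−2Δ} locally uniformly
on NonCoincident 3 2; n+2: on NonCoincident, (L) gives R^δ_n ≥ p_n/2 > 0 locally for small δ, hence
the exact lattice identity ρ^{n+2}G^δ_{n+2} = (ρ^n G^δ_n∘init)(ρ²G^δ_2∘last)/R^δ_n and locally
uniform convergence of products/quotients (TendstoLocallyUniformlyOn.mul, composition with the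
continuous maps init/last which preserve NonCoincident, denominators bounded below). (b)
IsNondegenerateTwoPoint: c > 0. (c) IsMoebiusCovariant Δ S, generator by generator and by induction
on n, both sides being 0 off the injective locus (translations, isometries, dilations c > 0 and ι on
(ℝ³∖0)^n preserve injectivity): S 2 is covariant by ‖(x+v)−(y+v)‖ = ‖x−y‖, isometry, ‖c x − c y‖ =
c‖x−y‖, and EuclideanGeometry.dist_inversion_inversion (‖ιx−ιy‖ = ‖x−y‖/(‖x‖‖y‖)); p_n is
translation invariant (exact lattice shift by δ⌊v/δ⌋ + continuity of p_n, from (L)), dilation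
invariant (R^δ_n(c x) = R^{δ/c}_n(x), from (L)), O(3) invariant (from (O) + (L): both R^δ_n(A∘x) and
R^δ_n(x) converge) and ι invariant (from (I) + (L)); the weights multiply up by Fin.prod_univ_add.
(d) HasNontrivialU4: multiply the inequality of (U) by ρ(δ)⁴, use (a) at n = 4 and at the six pairs
![xᵢ,xⱼ] ∈ NonCoincident 3 2, and pass to the limit along the frequently-filter: ε·S₂S₂ ≤
|limitConnectedFour S x| with S₂ > 0. Then ⟨ρ, Δ, S, …⟩ : Ising3DConformalLimit (root abbrev =
Literature.Probability.LatticeModels.CritIsing3DConformalLimit). Verified in Sketch.lean: all seven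
terms elaborate (rc 0); `Assembly ↔ (… → CritIsing3DConformalLimit)` and the identity of the r6 term
with
Summit.CriticalPhenomena.Ising3DConformalLimit.Theses.IsingEuclidUpgrade.IsingEuclidUpgradeR2RotInvPowerLaw
are Iff.rfl; rescaledCorrelator (criticalCorr 3) 1 n δ y = criticalCorr 3 n [y/δ] by simp. Expected
size 1–2.5 kLoC; a prover may land (a)–(d) as --supports lemmas.

Rationale: WHY THIS LINE. The part of Möbius covariance that has no lattice meaning — the weights |φ′(xᵢ)|^{−Δ}
and the renormalisation ρ(δ) — cancels EXACTLY in the ratios R^δ_n, and the telescoping identity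
G_{n+2} = G_n·G_2/R_n (exact on the lattice) rebuilds every even correlator from two-point functions
and ratios; so clause (ii) of the conjunct for all n is equivalent, given the two-point law (T) and
convergence (L), to INVARIANCE (not covariance) of finitely many bounded, dimensionless lattice
quantities under O(3) and one inversion — the shape in which conformal invariance of a critical
lattice model was first proved (Smirnov2001: invariance of a crossing probability; Cardy1992). The
switching lemma (GriffithsHurstSherman1970, AizenmanCMP1982, AizenmanDuminilCopinAnnals2021 §3)
makes R^δ_n a connection probability of sourced double random currents on δℤ³ (infinite volume at
β_c via AizenmanDuminilCopinSidoraviciusCMP2015), so (I)/(O) read: the macroscopic connectivity of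
critical currents is the same on the two conformally flat discretisations δℤ³ and φ(δℤ³) of a region
— a universality/coupling statement about one percolation-type object, attackable by the
stochastic-geometric toolbox (mixing and intersection properties of currents at regular scales,
AizenmanDuminilCopinAnnals2021 §6; 2D precedent: conformal invariance of double random currents,
arXiv:2107.12985, arXiv:2107.12880; currents ↔ loop-soup/GFF dictionary arXiv:1511.05524), while the
same dictionary turns clause (iii) into the merging of two independent sourced clusters (U).
Imported area: percolation-style scaling-limit technology (Cardy–Smirnov paradigm, arm/mixing
estimates) applied to random currents; no CFT axiomatics, no RG. What it does that the other routes
do not: IsingEuclidUpgrade/HyperoctahedralRP attack covariance of the correlators S_n through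
reflection positivity and harmonic analysis, IsingCFTData through CFT axioms,
PerfectScreening/AnomalousForcesInteraction only clause (iii) via the two-point function; this route
changes the OBJECT (weight-free ratios = connection probabilities, Δ-free and ρ-free) and the VERB
(invariance by coupling of currents across re-embedded lattices), and yields the first Δ-free
numerical test of 3D conformal invariance (cheapest falsifier). The negatives index (only
stmt-CriticalPhenomena-0772, SAW) is not touched; the typed refutations of 0632/0637/0663/0666 are
dodged because every crux here is a LATTICE statement about criticalCorr 3 (no limit family S is
quantified, except the ratio limit p_n whose properties are asserted on NonCoincident only) and the
assembly normalises S := 0 off NonCoincident.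

RANKED CRUXES. #2 RatioInversionInvariance (crux) — THE CARDY-TYPE TARGET (card crux (4)). For every
even n ≥ 2 and every non-coincident configuration x of n+2 points of ℝ³∖{0}, the weight-free ratio
R^δ_n(x) = ⟨σ_{[x₁/δ]}⋯σ_{[x_n/δ]}⟩⟨σ_{[x_{n+1}/δ]}σ_{[x_{n+2}/δ]}⟩ / ⟨σ_{[x₁/δ]}⋯σ_{[x_{n+2}/δ]}⟩
(plus state on ℤ³, β_c(3), h = 0; = P^{A∪{a,b},∅}_{β_c}[a ↔ b in n₁+n₂] by the switching lemma) is
asymptotically invariant under the unit inversion ι(y) = y/|y|² = EuclideanGeometry.inversion 0 1: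
R^δ_n(ι∘x) − R^δ_n(x) → 0 as δ → 0⁺ (both terms evaluated on the SAME lattice δℤ³). Equivalent,
given precompactness, to ι-invariance of every subsequential limit of R^δ_n. A consequence of the
conjunct itself (ratios of Möbius-covariant limits are Möbius-invariant because the weights cancel),
so a refutation refutes 3D conformal covariance of the spin correlations outright (given
convergence). Intended mechanism: ι(δℤ³) is the same abstract graph as δℤ³, so P computed on ι(δℤ³)
at the points ι(xᵢ) equals R^δ_n(x) exactly; the statement says the sourced currents of the two
discretisations δℤ³ and ι(δℤ³) of the same region have asymptotically equal macroscopic connection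
probabilities — locally ι(δℤ³) is a rotated–dilated cubic lattice with O(r) distortion on balls of
radius r, and the accumulated first-order response to ∇log|ι′| (where a virial current would live)
must be shown o(1). [difficulty: open-problem] (why it might fail: Nothing known forces the O(1)
accumulated response of sourced currents to the non-uniform dilation |ι′(y)| = |y|⁻² to vanish:
scale+rotation invariance of connection probabilities does not imply inversion invariance
(ScaleCovarianceNotMoebius); support is 2D theorems and Δ_V > 5 numerics only.)
[AizenmanDuminilCopinAnnals2021, AizenmanCMP1982, Smirnov2001, arXiv:2107.12985, MenesesEtAl2019,
DelamotteTissierWschebor2016, PolandRychkovVichi2019,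
Literature.Barriers.CriticalPhenomena.ScaleCovarianceNotMoebius]
#3 RatioLimit (crux) — EXISTENCE, CONTINUITY, POSITIVITY OF THE RATIO LIMITS (card cruxes
(3)+(uniqueness)). For every even n ≥ 2 there is p_n : (ℝ³)^{n+2} → ℝ, continuous and strictly
positive on NonCoincident 3 (n+2), such that R^δ_n → p_n as δ → 0⁺ along the FULL filter 𝓝[>]0,
locally uniformly on NonCoincident 3 (n+2). Two consequences are then free and are used by the
assembly: translation invariance of p_n (R^δ_n(x + δm) = R^δ_n(x) exactly for m ∈ ℤ³, by
Int.floor_add_int and plusCorr_shift, plus continuity of p_n) and dilation invariance of p_n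
(R^δ_n(c·x) = R^{δ/c}_n(x) exactly, since ⌊c a/δ⌋ = ⌊a/(δ/c)⌋). Tightness half: lattice-scale
equicontinuity of x ↦ R^δ_n(x) (moving one source by O(1) sites changes a macroscopic connection
probability by o(1): one-arm/mixing estimates for sourced currents in d = 3). Uniqueness half: all
subsequential limits coincide — the burden shared with items 0638 (IsingEuclidUpgrade r6) and
ExistsScaleCovariantLimit (HyperoctahedralRP), here placed on bounded dimensionless observables.
Positivity of p_n in the limit follows from (T) with GKS II upstairs and the Gaussian/Lebowitz-type
upper bound ⟨σ_A σ_aσ_b⟩ ≤ Σ_pairings downstairs once the limit exists; it is asserted here so that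
the assembly can divide. [difficulty: open-problem] (why it might fail: Needs lattice-scale
equicontinuity of sourced-current connection probabilities in d=3 (mixing/intersection control
exists only at regular scales, arXiv:1912.07973 §6) AND uniqueness of the δ→0⁺ limit, for which no
mechanism is known on ℤ³ (RigorousRGSmallParameter: no small parameter at ε=1).)
[AizenmanDuminilCopinAnnals2021, AizenmanDuminilCopinSidoraviciusCMP2015, DuminilCopinICM2022,
arXiv:2107.12880, Literature.Barriers.CriticalPhenomena.RigorousRGSmallParameter,
Literature.Probability.LatticeModels.CritIsing3DEuclideanLimit]
#4 RatioRotationInvariance (crux) — ROTATION UNIVERSALITY OF THE RATIOS. For every even n ≥ 2, every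
linear isometry A ∈ O(3) (LinearIsometryEquiv, reflections included) and every non-coincident x:
R^δ_n(A∘x) − R^δ_n(x) → 0 as δ → 0⁺. Reading: the sourced double currents of δℤ³ and of the rotated
lattice A(δℤ³) have asymptotically the same macroscopic connection probabilities (isotropy as
universality between two discretisations of one region; the hyperoctahedral A are NOT trivial
either, since ⌊−a/δ⌋ ≠ −⌊a/δ⌋, but follow from RatioLimit). Together with the isotropic two-point
law (T) this gives IsRotationInvariant of the reconstructed limit for all n. Alternative engines:
the nine-mirror reflection-positivity rigidity of route HyperoctahedralRP applied to ratios; a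
direct Δ-free Monte Carlo test (worm algorithm) is cheap. [difficulty: open-problem] (why it might
fail: Rotation invariance of any critical quantity on ℤ³ is only postulated (ICM22 §8.1 p.25); cubic
anisotropy may persist in macroscopic connection probabilities; no coupling of currents across ℤ³
and Aℤ³ is known and every proved isotropy engine is planar (arXiv:2012.11672).)
[DuminilCopinICM2022, arXiv:2012.11672, DengBlote2002,
Literature.Barriers.CriticalPhenomena.LiouvilleRigidity]
#5 NormalisedU4Nonvanishing (crux) — MERGING OF TWO SOURCED CURRENTS = Δ-FREE NON-GAUSSIANITY (card
crux (5)). There exist a non-coincident 4-tuple x ∈ (ℝ³)⁴ and ε > 0 such that, frequently as δ → 0⁺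
(i.e. along some sequence δ_k → 0), ε·G^δ_2(x₀,x₁)·G^δ_2(x₂,x₃) ≤ |U₄^δ(x)|, where U₄^δ(x) :=
G^δ_4(x) − [G^δ_2(x₀,x₁)G^δ_2(x₂,x₃) + G^δ_2(x₀,x₂)G^δ_2(x₁,x₃) + G^δ_2(x₀,x₃)G^δ_2(x₁,x₂)] is the
lattice Ursell function at the sites [xᵢ/δ] (odd correlations vanish at β_c(3) since m*(β_c) = 0,
spontaneousMagnetization_criticalBeta_eq_zero_holds, so this is the full U₄; same shape as
limitConnectedFour). By AizenmanDuminilCopinAnnals2021 eq. (3.11) (AizenmanCMP1982)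
|U₄^δ|/(G^δ_2G^δ_2) = 2·P^{x₀x₁,x₂x₃}_{β_c}[C_{n₁+n₂}([x₀/δ]) ∩ C_{n₁+n₂}([x₂/δ]) ≠ ∅]: the two
sourced double-current clusters at macroscopic separation MERGE with probability ≥ ε/2 along δ_k.
This lattice statement needs no scaling limit, no Δ and no ρ; for every full-filter non-degenerate
limit (ρ, S) it implies HasNontrivialU4 S (multiply by ρ(δ)⁴ and pass to the limit), i.e. it implies
item stmt-CriticalPhenomena-0636 — the natural support lemma to file with --supports once proved.
Engines: a d=3-specific second-moment/merging argument for independent sourced currents (the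
dimension count 2(2−η) > 3), or the two-point-function criteria of routes PerfectScreening /
AnomalousForcesInteraction. [difficulty: open-problem] (why it might fail: It IS 3D non-triviality:
rigorously not even the bubble Σ⟨σ₀σ_x⟩² is known to diverge at β_c(3) (lower bound only c/|x|²),
the second moment of intersections is controlled only by the tree bound, and the analogue fails for
d ≥ 4 and for RP long-range α < 3/2 on ℤ³.) [AizenmanCMP1982, AizenmanDuminilCopinAnnals2021,
Panis2023Triviality, DuminilcopinPanis2025,
Literature.Barriers.CriticalPhenomena.IsingTrivialityFromDimensionFour,
Literature.Barriers.CriticalPhenomena.LongRangeTrivialityOnZ3,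
Literature.Probability.LatticeModels.ursellFour_eq_doubleCurrent]
#6 IsingEuclidUpgradeR2RotInvPowerLaw (crux) — THE TWO-POINT LAW (card crux (2); SHARED item
stmt-CriticalPhenomena-0634 of route IsingEuclidUpgrade, same term): there are Δ and c > 0 with
⟨σ₀σ_x⟩_{β_c(3)}·‖x‖₂^{2Δ} → c as x → ∞ in ℤ³ (cofinite filter, Euclidean norm). In this route it
quarantines everything that carries a dimension: ρ(δ) := δ^{−Δ}, the value of Δ (forced into [1/2,1]
by criticalTwoPoint_bounds_holds, hence Δ > 0), existence of η = 2Δ − 1, and rotation invariance at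
the two-point level; the assembly turns it into ρ(δ)²⟨σ_{[x/δ]}σ_{[y/δ]}⟩ → c‖x−y‖^{−2Δ} locally
uniformly on NonCoincident 3 2 via plusCorr_shift. Ranked last here only because it is already
staffed through IsingEuclidUpgrade (rank 2 there). [difficulty: open-problem] (why it might fail: A
pure isotropic power law can fail three ways: η need not exist (log⟨σ₀σ_x⟩/log|x| may oscillate
inside the rigorous window Δ ∈ [1/2,1]), log corrections, or cubic anisotropy surviving in the
amplitude; such asymptotics are proved only by lace expansion (d ≫ 4) and in 2D.)
[DuminilCopinICM2022, DuminilcopinPanis2025, Sakai2007, arXiv:2012.11672,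
Literature.Probability.LatticeModels.criticalTwoPoint_bounds,
Literature.Barriers.CriticalPhenomena.LaceExpansionIsingAboveFour]
#9 RatioMemIoc (support) — THE RATIOS ARE PROBABILITIES: for every even n ≥ 2, every δ and every
configuration x (coincidences allowed), R^δ_n(x) ∈ (0,1]. Upper bound = GKS II for the plus state at
β_c (⟨σ_A σ_aσ_b⟩ ≥ ⟨σ_A⟩⟨σ_aσ_b⟩ for spin monomials; finite volume KellySherman1968/Griffiths, then
hasBoxLimit_isingCorr_plus / criticalCorr_wellDefined_holds); positivity = iterated GKS II down to
pairs and ⟨σ_uσ_v⟩_{β_c} ≥ min(1, c‖u−v‖^{−2}) > 0 (criticalTwoPoint_bounds_holds, d = 3), with σ² =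
1 handling repeated sites (exists_spinMonomial_eq_spinProduct). Provable now; gives the a-priori
bounds used by provers of RatioLimit and is the formal shadow of the switching-lemma reading R = P[a
↔ b]. [difficulty: provable-now] [KellySherman1968, GriffithsHurstSherman1970, FriedliVelenik2017,
AizenmanDuminilCopinAnnals2021, Literature.Probability.LatticeModels.criticalTwoPoint_bounds]

TWO-LAYER PLAN. Foreseen glued splits (none filed now): RatioLimit ⇐ RatioTight → RatioUnique →
RatioLimit (RatioTight: lattice-scale equicontinuity = every sequence δ_k → 0 has a locally
uniformly convergent subsequence with continuous positive limit; RatioUnique: any two subsequential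
limits agree); RatioInversionInvariance ⇐ LocalDistortion → GlobalGluing → RatioInversionInvariance
(LocalDistortion: connection probabilities of sourced currents are insensitive, to first order, to
an O(r²/R)-quasi-isometric perturbation of the lattice on a ball of radius r at distance R from the
centre of inversion; GlobalGluing: the first-order responses sum to o(1) — the 'no virial current'
step); NormalisedU4Nonvanishing ⇐ FirstMomentDiverges → SecondMomentBound → NormalisedU4Nonvanishing
(merging by Cauchy–Schwarz for two INDEPENDENT sourced currents, AizenmanDuminilCopinAnnals2021
Lemma 4.4/6.2 shape, IntersectionSecondMoment.lean). The support lemma 'NormalisedU4Nonvanishing →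
item 0636' and the four assembly steps (a)–(d) ride as --supports lemmas, never items.

KILL CRITERIA. A refutation of RatioInversionInvariance (e.g. a certified or overwhelming
worm-algorithm discrepancy between R^δ_2 at (e,2e,3e,4e)-type configurations and their inverse
images, stable in L) closes the route (close --reason refuted:RatioInversionInvariance) AND is
evidence against clause (ii) of the conjunct itself; a refutation of RatioRotationInvariance
likewise (cubic anisotropy survives) and kills every covariance route; a refutation of RatioLimit
through NON-UNIQUENESS (log-periodic ratios) forces a pivot of the whole summit statement to
subsequential limits, through failure of continuity/positivity only a restatement; a refutation of
NormalisedU4Nonvanishing refutes Ising3DConformalLimit (clause (iii)) for everybody; a refutation of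
0634 by anisotropy of the amplitude kills (T) here and r2 of IsingEuclidUpgrade alike, by mere
non-existence of the pure power law (log corrections) it forces restating (T) with a slowly varying
ρ. Proved elsewhere ⇒ moot here: 0636 does NOT moot (U) (U is stronger), but
ExistsScaleCovariantLimit-type items plus 0634 would reduce RatioLimit to continuity/positivity
bookkeeping.

NOT DECOMPOSED YET. Deliberately not decomposed at open: the tightness/uniqueness split of
RatioLimit; the local/global split of the inversion coupling; the second-moment engine for (U); the
infinite-volume SOURCED double-current measure at β_c and the source-insertion identity on ℤ³
(definition request below — the cruxes are typed purely in criticalCorr 3 so that no unproved named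
fact enters the import cone); the a-priori Hölder/one-arm estimates for sourced currents in d = 3;
negations (¬RatioInversionInvariance etc.) are not filed — the cheapest refutations are numerical
and would enter as evidence, not theorems.

CHEAPEST FALSIFIER. Δ-FREE INVERSION TEST BY WORM SAMPLING (not run in this unit; first refuter with
compute). Sample sourced double currents at β_c(3) = 0.221654626(5) with the Prokof'ev–Svistunov
worm algorithm on L³ tori, L = 64…256; measure R^δ_2 = ⟨σ_xσ_y⟩⟨σ_zσ_t⟩/⟨σ_xσ_yσ_zσ_t⟩ =
P^{xyzt,∅}[z ↔ t] for collinear 4-tuples (a,2a,3a,4a)e₁ and for their images under a unit inversion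
whose centre puts all eight points at separations 8 ≤ r ≤ L/4 (the two 4-tuples are related by NO
similarity, so only inversion invariance predicts equality). Route prediction: equality up to
finite-size drift O((a/r)^ω), ω ≈ 0.83; a stable discrepancy refutes RatioInversionInvariance and
clause (ii) itself. The same run tests RatioRotationInvariance (irrational rotation of the tuple)
and measures the merging frequency |U₄|/(2⟨⟩⟨⟩) for (U). FORMAL check done: r6 = stmt-0634 verbatim
(Iff.rfl, Sketch.lean); no crux quantifies a limit family over coincident configurations or over
renormalisations, so the junk-value refutations of Theorems/IsingEuclidUpgradeRefutations.lean and
IsingCFTDataRefutations.lean do not apply (p_n is constrained on NonCoincident only; the assembly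
sets S := 0 elsewhere).

NUMBERS. β_c(3) = 0.221654626(5); Δ_σ = 0.5181489(10), η = 0.036298(2) (bootstrap,
PolandRychkovVichi2019); rigorous window Δ ∈ [1/2, 1] (criticalTwoPoint_bounds_holds: c‖x‖⁻² ≤
⟨σ₀σ_x⟩_{β_c(3)} ≤ C‖x‖⁻¹); η ≤ 1/2 if it exists (DuminilcopinPanis2025 Thm 1.5); virial-candidate
bound Δ_V > 5.0 (MenesesEtAl2019); merging dimension count: two independent clusters of Hausdorff
dimension 2 − η ≈ 1.96 each in ℝ³, 2(2−η) − 3 ≈ 0.93 > 0; correction-to-scaling ω ≈ 0.8297.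

DEFINITION REQUESTS. (1) notion sourcedDoubleCurrentLaw (topic
Literature/Probability/LatticeModels): for d ≥ 2, 0 ≤ β ≤ β_c(d) and finite A ⊂ ℤ^d with ⟨σ_A⟩ > 0,
the infinite-volume law P^{A,∅}_β of the traced sum n₁+n₂ of independent currents with ∂n₁ = A, ∂n₂
= ∅ (weak limit of box currents, AizenmanDuminilCopinSidoraviciusCMP2015 Thm 2.3 / §2.3, extending
adsDoubleCurrentLawInf = P^{∅,∅}), together with the SOURCE-INSERTION IDENTITY ⟨σ_A⟩⟨σ_B⟩ =
⟨σ_{AΔB}⟩·P^{AΔB,∅}_β[n₁+n₂ ∈ F_B] for the plus (= free) state at β_c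
(AizenmanDuminilCopinAnnals2021 §3.2 displays (3.9)–(3.10) and footnote 5, arXiv p. 9; finite-volume
form = Literature.Probability.LatticeModels.isingCorr_mul_eq_doubleCurrent_subcurrent, still a named
fact). Filed with `ledger workitem add --kind definition` for RatioInversionInvariance after open.
(2) cite fact wanted: ADC21 eq. (3.11) in infinite volume at β_c(3) for the plus state (finite-graph
form = ursellFour_eq_doubleCurrent, named fact).

Novelty: Searches (2026-08-15, this planner; the card's own 2026-08-15 sweep is recorded on the card and was
re-graded by refuter-novelty-audit-CriticalPhenomena-Ising3DConformalLimit-1-0): lit search --hybrid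
"switching lemma random currents ratio of correlation functions connection probability conformal
invariance" (12 book hits, none on currents' conformal invariance: FriedliVelenik2017 p.161,
Lawler2005, DiFrancesco1997); lit search --source s2 "random currents connection probability
conformal invariance three dimensions Ising" (13 rows: DuminilCopin2017 lectures arXiv:1707.00520,
nothing 3D-conformal); lit search --source crossref "conformal invariance three-dimensional Ising
Monte Carlo" (20 rows: DelamotteTissierWschebor2016 doi:10.1103/physreve.93.012144, Deng–Blöte
doi:10.1103/physreve.67.066116, Saberi–Dashti-Naserabadi doi:10.1209/0295-5075/92/67005 — 2D
sections/SLE, Δ-dependent or planar tests only); lit galaxy search "double random current" --star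
pdf (4 hits: Lis arXiv:1909.07351, DuminilCopinICM2022, arXiv:2310.02087 complete graph,
arXiv:2306.05130 — all 2D/mean-field); lit galaxy search "random current representation conformal
invariance" --star all (0 hits); lit frontier CriticalPhenomena --since 2020 (arXiv:2604.05772
'Percolation in the three-dimensional Ising model', geometric clusters, Δ-dependent); lit read
arXiv:1912.07973 pp. 8–9 (Lemma 3.3, ratio identity, eq. (3.11) confirmed verbatim); openalex/arxiv
APIs rate-limited this session (HTTP 429), recorded in N  [refs: 10.1103/physreve.93.012144, 10.1103/physreve.67.066116, 10.1209/0295-5075/92/67005, 1707.00520, 1909.07351, 2310.02087, 2306.05130, 2604.05772, 1912.07973, 2107.12985, 2107.12880, doi:10.1103/physreve.93.012144, doi:10.1103/physreve.67.066116, doi:10.1209/0295-5075/92/67005, FriedliVelenik2017, Lawler2005, DelamotteTissierWschebor2016, DuminilCopinICM2022, AizenmanDuminilCopinAnnals2021, Smirnov20]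

Barriers (technique_class: random-currents, switching-lemma, cardy-type-invariance): - technique_class: random-currents, switching-lemma, cardy-type-invariance
- Literature.Barriers.CriticalPhenomena.ScaleCovarianceNotMoebius: its witness is a bare CorrFamily
3 with no lattice behind it (scope caveat (a)); here inversion invariance is asked only of limits of
ratios of criticalCorr 3 and the proposed proof is Ising-specific (coupling of sourced currents
across δℤ³ and ι(δℤ³)); the route never claims 'scale ⇒ conformal' — RatioInversionInvariance is a
separate crux precisely because the barrier says it must be.
- Literature.Barriers.CriticalPhenomena.IsingTrivialityFromDimensionFour: meets only
NormalisedU4Nonvanishing; a dimension-uniform proof is impossible (d ≥ 4 Gaussian), so the merging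
argument must use a d = 3 input — the dimension count 2(2−η) > 3 for two independent sourced
clusters and d = 3 two-point lower bounds (criticalTwoPoint_bounds_holds, DuminilcopinPanis2025);
the covariance cruxes (I), (L), (O) are untouched by it.
- Literature.Barriers.CriticalPhenomena.LongRangeTrivialityOnZ3: same clause; an interaction-uniform
proof on ℤ³ is impossible (RP long-range α < 3/2 is Gaussian), and the intended count is
interaction-specific as required (for couplings |x|^{−3−α} the first moment reads R^{2α−3},
divergent exactly for α > 3/2); honest status: it does not yet evade it by a theorem; the bet is a
nearest-neighbour-specific second-moment bound.
- Literature.Barriers.CriticalPhenomena.LiouvilleRigidity: respected, not evaded — only the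
ten-parameter M

History (route lifecycle, newest last):
- 2026-08-24T20:52:00Z · DORMANT — reconciler: no traction for 7.1 d (last activity item-evidence-added at 2026-08-17T18:45:47Z); parked, not closed — `ledger route dormant route-CriticalPhenomen (operator:999:2270283)
- 2026-08-31T08:36:33Z · REACTIVATED (open) — reconciler: reactivated — activity statement-checked at 2026-08-31T07:40:23Z after parking at 2026-08-24T20:52:00Z (operator:999:574690)

sub-problem: Ising3DConformalLimit · status: open · opened planner-plancard-CriticalPhenomena-Ising3DCon-360b7db7-0 2026-08-15T11:35:15Z · rev 2 · ledger route-CriticalPhenomena-CurrentConnectionInvariance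
GENERATED by the gate from the ledger (D-0016/17). Provers cite these decls: `theorem foo : Summit.CriticalPhenomena.Ising3DConformalLimit.Theses.CurrentConnectionInvariance.<Decl> := …` in Summits/CriticalPhenomena/Ising3DConformalLimit/Theorems/<Name>.lean.
-/

namespace Summit.CriticalPhenomena.Ising3DConformalLimit.Theses.CurrentConnectionInvariance

open scoped BigOperators Topology Manifold Classical MeasureTheory ProbabilityTheory Matrix InnerProductSpace ComplexConjugate ContinuousMap
open Filter Set Function TopologicalSpace MeasureTheory

attribute [summit_statement] _root_.Ising3DConformalLimit

/-- item stmt-CriticalPhenomena-4840 · crux · rank 2 · open · by planner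
why it might fail: Nothing known forces the O(1) accumulated response of sourced currents to the non-uniform dilation |ι′(y)| = |y|⁻² to vanish: scale+rotation invariance of connection probabilities does not imply inversion invariance (ScaleCovarianceNotMoebius); support is 2D theorems and Δ_V > 5 numerics only.
sources: AizenmanDuminilCopinAnnals2021, AizenmanCMP1982, Smirnov2001, arXiv:2107.12985, MenesesEtAl2019, DelamotteTissierWschebor2016
[crux] THE CARDY-TYPE TARGET (card crux (4)). For every even n ≥ 2 and every non-coincident
configuration x of n+2 points of ℝ³∖{0}, the weight-free ratio R^δ_n(x) =
⟨σ_{[x₁/δ]}⋯σ_{[x_n/δ]}⟩⟨σ_{[x_{n+1}/δ]}σ_{[x_{n+2}/δ]}⟩ / ⟨σ_{[x₁/δ]}⋯σ_{[x_{n+2}/δ]}⟩ (plus state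
on ℤ³, β_c(3), h = 0; = P^{A∪{a,b},∅}_{β_c}[a ↔ b in n₁+n₂] by the switching lemma) is
asymptotically invariant under the unit inversion ι(y) = y/|y|² = EuclideanGeometry.inversion 0 1:
R^δ_n(ι∘x) − R^δ_n(x) → 0 as δ → 0⁺ (both terms evaluated on the SAME lattice δℤ³). Equivalent,
given precompactness, to ι-invariance of every subsequential limit of R^δ_n. A consequence of the
conjunct itself (ratios of Möbius-covariant limits are Möbius-invariant because the weights cancel),
so a refutation refutes 3D conformal covariance of the spin correlations outright (given
convergence). Intended mechanism: ι(δℤ³) is the same abstract graph as δℤ³, so P computed on ι(δℤ³)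
at the points ι(xᵢ) equals R^δ_n(x) exactly; the statement says the sourced currents of the two
discretisations δℤ³ and ι(δℤ³) of the same region have asymptotically equal macroscopic connection
probabilities — locally ι(δℤ³) is a rotated–dilated cubic lattice wit -/
@[route_item "route-CriticalPhenomena-CurrentConnectionInvariance", crux]
def RatioInversionInvariance : Prop :=
  open Literature.Probability.LatticeModels in ∀ n : ℕ, Even n → 2 ≤ n → ∀ x ∈ NonCoincident 3 (n + 2), (∀ i, x i ≠ 0) → Filter.Tendsto (fun δ : ℝ => rescaledCorrelator (criticalCorr 3) 1 n δ (fun i => EuclideanGeometry.inversion 0 1 (x (Fin.castAdd 2 i))) * rescaledCorrelator (criticalCorr 3) 1 2 δ (fun i => EuclideanGeometry.inversion 0 1 (x (Fin.natAdd n i))) / rescaledCorrelator (criticalCorr 3) 1 (n + 2) δ (fun i => EuclideanGeometry.inversion 0 1 (x i)) - rescaledCorrelator (criticalCorr 3) 1 n δ (fun i => x (Fin.castAdd 2 i)) * rescaledCorrelator (criticalCorr 3) 1 2 δ (fun i => x (Fin.natAdd n i)) / rescaledCorrelator (criticalCorr 3) 1 (n + 2) δ x) (𝓝[>] (0 : ℝ))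 (𝓝 0)

/-- item stmt-CriticalPhenomena-4841 · crux · rank 3 · open · by planner
why it might fail: Needs lattice-scale equicontinuity of sourced-current connection probabilities in d=3 (mixing/intersection control exists only at regular scales, arXiv:1912.07973 §6) AND uniqueness of the δ→0⁺ limit, for which no mechanism is known on ℤ³ (RigorousRGSmallParameter: no small parameter at ε=1).
sources: AizenmanDuminilCopinAnnals2021, AizenmanDuminilCopinSidoraviciusCMP2015, DuminilCopinICM2022, arXiv:2107.12880, Literature.Barriers.CriticalPhenomena.RigorousRGSmallParameter, Literature.Probability.LatticeModels.CritIsing3DEuclideanLimit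
[crux] EXISTENCE, CONTINUITY, POSITIVITY OF THE RATIO LIMITS (card cruxes (3)+(uniqueness)). For
every even n ≥ 2 there is p_n : (ℝ³)^{n+2} → ℝ, continuous and strictly positive on NonCoincident 3
(n+2), such that R^δ_n → p_n as δ → 0⁺ along the FULL filter 𝓝[>]0, locally uniformly on
NonCoincident 3 (n+2). Two consequences are then free and are used by the assembly: translation
invariance of p_n (R^δ_n(x + δm) = R^δ_n(x) exactly for m ∈ ℤ³, by Int.floor_add_int and
plusCorr_shift, plus continuity of p_n) and dilation invariance of p_n (R^δ_n(c·x) = R^{δ/c}_n(x)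
exactly, since ⌊c a/δ⌋ = ⌊a/(δ/c)⌋). Tightness half: lattice-scale equicontinuity of x ↦ R^δ_n(x)
(moving one source by O(1) sites changes a macroscopic connection probability by o(1):
one-arm/mixing estimates for sourced currents in d = 3). Uniqueness half: all subsequential limits
coincide — the burden shared with items 0638 (IsingEuclidUpgrade r6) and ExistsScaleCovariantLimit
(HyperoctahedralRP), here placed on bounded dimensionless observables. Positivity of p_n in the
limit follows from (T) with GKS II upstairs and the Gaussian/Lebowitz-type upper bound ⟨σ_A σ_aσ_b⟩
≤ Σ_pairings downstairs once the limit exists; it is -/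
@[route_item "route-CriticalPhenomena-CurrentConnectionInvariance", crux]
def RatioLimit : Prop :=
  open Literature.Probability.LatticeModels in ∀ n : ℕ, Even n → 2 ≤ n → ∃ p : (Fin (n + 2) → EuclideanSpace ℝ (Fin 3)) → ℝ, ContinuousOn p (NonCoincident 3 (n + 2)) ∧ (∀ x ∈ NonCoincident 3 (n + 2), 0 < p x) ∧ TendstoLocallyUniformlyOn (fun (δ : ℝ) (x : Fin (n + 2) → EuclideanSpace ℝ (Fin 3)) => rescaledCorrelator (criticalCorr 3) 1 n δ (fun i => x (Fin.castAdd 2 i)) * rescaledCorrelator (criticalCorr 3) 1 2 δ (fun i => x (Fin.natAdd n i)) / rescaledCorrelator (criticalCorr 3) 1 (n + 2) δ x) p (𝓝[>] (0 : ℝ)) (NonCoincident 3 (n + 2))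

/-- item stmt-CriticalPhenomena-4842 · crux · rank 4 · open · by planner
why it might fail: Rotation invariance of any critical quantity on ℤ³ is only postulated (ICM22 §8.1 p.25); cubic anisotropy may persist in macroscopic connection probabilities; no coupling of currents across ℤ³ and Aℤ³ is known and every proved isotropy engine is planar (arXiv:2012.11672).
sources: DuminilCopinICM2022, arXiv:2012.11672, DengBlote2002, Literature.Barriers.CriticalPhenomena.LiouvilleRigidity
[crux] ROTATION UNIVERSALITY OF THE RATIOS. For every even n ≥ 2, every linear isometry A ∈ O(3)
(LinearIsometryEquiv, reflections included) and every non-coincident x: R^δ_n(A∘x) − R^δ_n(x) → 0 as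
δ → 0⁺. Reading: the sourced double currents of δℤ³ and of the rotated lattice A(δℤ³) have
asymptotically the same macroscopic connection probabilities (isotropy as universality between two
discretisations of one region; the hyperoctahedral A are NOT trivial either, since ⌊−a/δ⌋ ≠ −⌊a/δ⌋,
but follow from RatioLimit). Together with the isotropic two-point law (T) this gives
IsRotationInvariant of the reconstructed limit for all n. Alternative engines: the nine-mirror
reflection-positivity rigidity of route HyperoctahedralRP applied to ratios; a direct Δ-free Monte
Carlo test (worm algorithm) is cheap. [difficulty: open-problem] -/
@[route_item "route-CriticalPhenomena-CurrentConnectionInvariance", crux]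
def RatioRotationInvariance : Prop :=
  open Literature.Probability.LatticeModels in ∀ n : ℕ, Even n → 2 ≤ n → ∀ (A : EuclideanSpace ℝ (Fin 3) ≃ₗᵢ[ℝ] EuclideanSpace ℝ (Fin 3)), ∀ x ∈ NonCoincident 3 (n + 2), Filter.Tendsto (fun δ : ℝ => rescaledCorrelator (criticalCorr 3) 1 n δ (fun i => A (x (Fin.castAdd 2 i))) * rescaledCorrelator (criticalCorr 3) 1 2 δ (fun i => A (x (Fin.natAdd n i))) / rescaledCorrelator (criticalCorr 3) 1 (n + 2) δ (fun i => A (x i)) - rescaledCorrelator (criticalCorr 3) 1 n δ (fun i => x (Fin.castAdd 2 i)) * rescaledCorrelator (criticalCorr 3) 1 2 δ (fun i => x (Fin.natAdd n i)) / rescaledCorrelator (criticalCorr 3) 1 (n + 2) δ x) (𝓝[>] (0 : ℝ)) (𝓝 0)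

/-- item stmt-CriticalPhenomena-4843 · crux · rank 5 · open · by planner
why it might fail: It IS 3D non-triviality: only the first-moment half is known (bubble Σ⟨σ₀σ_x⟩² = ∞ at β_c(3): DCP25 Thm 1.8, proved in tree, log-divergent only); no merging/second-moment lower bound for two sourced currents exists in d = 3; the analogue fails for d ≥ 4 and RP long-range α < 3/2 on ℤ³.
sources: AizenmanCMP1982, AizenmanDuminilCopinAnnals2021, Panis2023Triviality, DuminilCopinPanis2025LowerBounds, Literature.Probability.LatticeModels.DuminilCopinPanis2025_bubbleDiagram_eq_top_holds, Literature.Probability.LatticeModels.ursellFour_eq_doubleCurrent_holds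
[crux] MERGING OF TWO SOURCED CURRENTS = Δ-FREE NON-GAUSSIANITY (card crux (5)). There exist a
non-coincident 4-tuple x ∈ (ℝ³)⁴ and ε > 0 such that, frequently as δ → 0⁺ (i.e. along some sequence
δ_k → 0), ε·G^δ_2(x₀,x₁)·G^δ_2(x₂,x₃) ≤ |U₄^δ(x)|, where U₄^δ(x) := G^δ_4(x) −
[G^δ_2(x₀,x₁)G^δ_2(x₂,x₃) + G^δ_2(x₀,x₂)G^δ_2(x₁,x₃) + G^δ_2(x₀,x₃)G^δ_2(x₁,x₂)] is the lattice
Ursell function at the sites [xᵢ/δ] (odd correlations vanish at β_c(3) since m*(β_c) = 0,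
spontaneousMagnetization_criticalBeta_eq_zero_holds, so this is the full U₄; same shape as
limitConnectedFour). By AizenmanDuminilCopinAnnals2021 eq. (3.11) (AizenmanCMP1982)
|U₄^δ|/(G^δ_2G^δ_2) = 2·P^{x₀x₁,x₂x₃}_{β_c}[C_{n₁+n₂}([x₀/δ]) ∩ C_{n₁+n₂}([x₂/δ]) ≠ ∅]: the two
sourced double-current clusters at macroscopic separation MERGE with probability ≥ ε/2 along δ_k.
This lattice statement needs no scaling limit, no Δ and no ρ; for every full-filter non-degenerate
limit (ρ, S) it implies HasNontrivialU4 S (multiply by ρ(δ)⁴ and pass to the limit), i.e. it implies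
item stmt-CriticalPhenomena-0636 — the natural support lemma to file with --supports once proved.
Engines: a d=3-specific second-moment/merging argument for independent s -/
@[route_item "route-CriticalPhenomena-CurrentConnectionInvariance", crux]
def NormalisedU4Nonvanishing : Prop :=
  open Literature.Probability.LatticeModels in ∃ x ∈ NonCoincident 3 4, ∃ ε : ℝ, 0 < ε ∧ ∃ᶠ δ in 𝓝[>] (0 : ℝ), ε * (rescaledCorrelator (criticalCorr 3) 1 2 δ ![x 0, x 1] * rescaledCorrelator (criticalCorr 3) 1 2 δ ![x 2, x 3]) ≤ |rescaledCorrelator (criticalCorr 3) 1 4 δ x - (rescaledCorrelator (criticalCorr 3) 1 2 δ ![x 0, x 1] * rescaledCorrelator (criticalCorr 3) 1 2 δ ![x 2, x 3] + rescaledCorrelator (criticalCorr 3) 1 2 δ ![x 0, x 2] * rescaledCorrelator (criticalCorr 3) 1 2 δ ![x 1, x 3] + rescaledCorrelator (criticalCorr 3) 1 2 δ ![x 0, x 3] * rescaledCorrelator (criticalCorr 3) 1 2 δ ![x 1, x 2])|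

/-- item stmt-CriticalPhenomena-0634 · crux · rank 6 · open · by planner
why it might fail: A pure isotropic power law can fail three ways: η need not exist (log⟨σ₀σ_x⟩/log|x| may oscillate inside the rigorous window Δ ∈ [1/2,1]), log corrections, or cubic anisotropy surviving in the amplitude; such asymptotics are proved only by lace expansion (d ≫ 4) and in 2D.
sources: DuminilCopinICM2022, DuminilcopinPanis2025, Sakai2007, arXiv:2012.11672, Literature.Probability.LatticeModels.criticalTwoPoint_bounds, Literature.Barriers.CriticalPhenomena.LaceExpansionIsingAboveFour
Crux r2 (hardest, most informative): the critical two-point function of the n.n. Ising model on Z^3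
is asymptotically a rotation-invariant pure power law: there are Δ and c>0 with ⟨σ_0 σ_x⟩_{β_c(3)} ·
|x|_2^{2Δ} → c as |x| → ∞ (Euclidean norm, cofinite filter on Z^3). Gives existence of η = 2Δ−1,
forces ρ(δ) ≍ δ^{-Δ}, and is rotation invariance at the two-point level (open on Z^3: Duminil-Copin
ICM2022 arXiv:2208.00864 §8; 2-D analogue for FK models: DKKMO arXiv:2012.11672). Known input:
c|x|^{-2} ≤ ⟨σ0σx⟩ ≤ C|x|^{-1} (Literature.Probability.LatticeModels.criticalTwoPoint_bounds), so Δ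
∈ [1/2,1] if it exists. -/
@[route_item "route-CriticalPhenomena-CurrentConnectionInvariance", crux]
def IsingEuclidUpgradeR2RotInvPowerLaw : Prop :=
  ∃ Δ c : ℝ, 0 < c ∧ Filter.Tendsto (fun x : Literature.Probability.LatticeModels.Site 3 => Literature.Probability.LatticeModels.criticalTwoPoint 3 x * Real.sqrt (∑ i, ((x i : ℝ)) ^ 2) ^ (2 * Δ)) Filter.cofinite (nhds c)

/-- item stmt-CriticalPhenomena-17687 · support · rank 9 · open · by planner
[support] GLUE OF THE STRATEGIST SPLIT (crux-strategist cstrat-4843, BC2 redirect; PROVABLE NOW —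
proved sorry-free, proof attached as evidence / crux workfile
Cruxes/NormalisedU4Nonvanishing/NormalisedU4NonvanishingSplit.lean, theorem
normalisedU4Nonvanishing_of_limit; a prover lands that file as
Theorems/CurrentConnectionInvarianceNormalisedU4NonvanishingSplit.lean and closes this item with
`theorem … : NormalisedU4NonvanishingOfLimit := fun hL hNG => normalisedU4Nonvanishing_of_limit hL
hNG`): LimitExists (item stmt-CriticalPhenomena-4738, inlined verbatim) → NonGaussianLimit (item
stmt-CriticalPhenomena-0636, inlined verbatim) → NormalisedU4Nonvanishing. Existence of a
non-degenerate pointwise scaling limit plus non-Gaussianity of every such limit give the crux: along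
the full filter ρ(δ)⁴U₄^δ(x) → U₄(S)(x) ≠ 0 and ρ(δ)⁴G^δ₂G^δ₂ → S₂S₂ > 0 at the non-coincident x
supplied by 0636 (the weights cancel in the crux ratio), ε := |U₄(S)(x)|/(2S₂S₂), eventually hence
frequently. Converse (same file): the crux implies 0636. Intended use: `route edit --split
NormalisedU4Nonvanishing --into children.json --glue-by <the landed theorem>` (children verbatim
4738/0636; the split command itse -/
@[route_item "route-CriticalPhenomena-CurrentConnectionInvariance"]
def NormalisedU4NonvanishingOfLimit : Prop :=
  (∃ (ρ : ℝ → ℝ) (S : Literature.Probability.LatticeModels.CorrFamily 3), (∀ δ ∈ Set.Ioc (0:ℝ) 1, 0 < ρ δ) ∧ Literature.Probability.LatticeModels.HasPointwiseScalingLimit (Literature.Probability.LatticeModels.criticalCorr 3) ρ S ∧ Literature.Probability.LatticeModels.IsNondegenerateTwoPoint S) → (∀ (ρ : ℝ → ℝ) (S : Literature.Probability.LatticeModels.CorrFamily 3), (∀ δ ∈ Set.Ioc (0:ℝ) 1, 0 < ρ δ) → Literature.Probability.LatticeModels.HasPointwiseScalingLimit (Literature.Probability.LatticeModels.criticalCorr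 3) ρ S → Literature.Probability.LatticeModels.IsNondegenerateTwoPoint S → Literature.Probability.LatticeModels.HasNontrivialU4 S) → NormalisedU4Nonvanishing

/-- item stmt-CriticalPhenomena-4844 · support · rank 9 · open · by planner
sources: KellySherman1968, GriffithsHurstSherman1970, FriedliVelenik2017, AizenmanDuminilCopinAnnals2021, Literature.Probability.LatticeModels.criticalTwoPoint_bounds
[support] THE RATIOS ARE PROBABILITIES: for every even n ≥ 2, every δ and every configuration x
(coincidences allowed), R^δ_n(x) ∈ (0,1]. Upper bound = GKS II for the plus state at β_c (⟨σ_A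
σ_aσ_b⟩ ≥ ⟨σ_A⟩⟨σ_aσ_b⟩ for spin monomials; finite volume KellySherman1968/Griffiths, then
hasBoxLimit_isingCorr_plus / criticalCorr_wellDefined_holds); positivity = iterated GKS II down to
pairs and ⟨σ_uσ_v⟩_{β_c} ≥ min(1, c‖u−v‖^{−2}) > 0 (criticalTwoPoint_bounds_holds, d = 3), with σ² =
1 handling repeated sites (exists_spinMonomial_eq_spinProduct). Provable now; gives the a-priori
bounds used by provers of RatioLimit and is the formal shadow of the switching-lemma reading R = P[a
↔ b]. [difficulty: provable-now] -/
@[route_item "route-CriticalPhenomena-CurrentConnectionInvariance", crux]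
def RatioMemIoc : Prop :=
  open Literature.Probability.LatticeModels in ∀ n : ℕ, Even n → 2 ≤ n → ∀ (δ : ℝ) (x : Fin (n + 2) → EuclideanSpace ℝ (Fin 3)), rescaledCorrelator (criticalCorr 3) 1 n δ (fun i => x (Fin.castAdd 2 i)) * rescaledCorrelator (criticalCorr 3) 1 2 δ (fun i => x (Fin.natAdd n i)) / rescaledCorrelator (criticalCorr 3) 1 (n + 2) δ x ∈ Set.Ioc (0 : ℝ) 1

/-- item stmt-CriticalPhenomena-4845 · assembly · rank 1 · open · by planner
sources: idea card Summits/CriticalPhenomena/Ising3DConformalLimit/Ideas/current-connection-invariance.md, AizenmanDuminilCopinAnnals2021, ChelkakHonglerIzyurov2015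
[assembly] RatioInversionInvariance → RatioLimit → RatioRotationInvariance →
NormalisedU4Nonvanishing → IsingEuclidUpgradeR2RotInvPowerLaw → Ising3DConformalLimit, by the
telescoped reconstruction above (S := 0 off NonCoincident; ρ := δ^{−Δ}). -/
@[route_item "route-CriticalPhenomena-CurrentConnectionInvariance", crux]
def Assembly : Prop :=
  RatioInversionInvariance → RatioLimit → RatioRotationInvariance → NormalisedU4Nonvanishing → IsingEuclidUpgradeR2RotInvPowerLaw → Ising3DConformalLimit

/-! D-0027 §2.1 — DECIDING THEOREM (planner-authored via `route open/edit --closes-file`; by operator:999:2941348 2026-08-15T15:21:16Z):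
its hypotheses are this route's items and its conclusion the sub-problem Statement (glue_lint), and it elaborates with this file. -/

@[closes "route-CriticalPhenomena-CurrentConnectionInvariance"] theorem closes : RatioInversionInvariance → RatioLimit → RatioRotationInvariance → NormalisedU4Nonvanishing → IsingEuclidUpgradeR2RotInvPowerLaw → RatioMemIoc → Assembly → _root_.Ising3DConformalLimit := fun h_RatioInversionInvariance h_RatioLimit h_RatioRotationInvariance h_NormalisedU4Nonvanishing h_IsingEuclidUpgradeR2RotInvPowerLaw h_RatioMemIoc h_Assembly => h_Assembly h_RatioInversionInvariance h_RatioLimit h_RatioRotationInvariance h_NormalisedU4Nonvanishing h_IsingEuclidUpgradeR2RotInvPowerLaw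

end Summit.CriticalPhenomena.Ising3DConformalLimit.Theses.CurrentConnectionInvariance
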